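import Literature.AlgebraicGeometry.Motives.MixedHodgeStructureCatWeightTruncation
import Literature.AlgebraicGeometry.Motives.MixedHodgeStructureCatWeightsSumsHodgeClasses
import HarnessLib

/-!
# Hodge classes only see `W_{2p}`: `Hdgᵖ(W_k X) = Hdgᵖ(X)` for `k ≥ 2p`, `Hdgᵖ(X) ↪ Hdgᵖ(X ∕ W_k X)` for `k < 2p`, and `Hdgᵖ(X) ↪ Hdgᵖ(W_{[a,b]} X)`

Layer `Literature/AlgebraicGeometry/Motives` (lane `lit-hodgefound`), joining the weight-truncation files of generation 44 (`…WeightTorsionTheory`: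
the universal property `weightLift` of `W_k X ↪ X`; `…WeightTruncation`: `W_{[a,b]}`; `…WeightsSumsHodgeClasses`: `Hdgᵖ(X) = 0` when `2p` is not a
weight) with the functor of HODGE CLASSES `hodgeClassesFunctor p : MixedHodgeStructureCat ⥤ ModuleCat ℚ` (`Motives/MixedHodgeStructureCatHodgeClasses`,
corepresented by `ℚ(-p)`: `homTateLinearEquiv`).  Since `Hdgᵖ(X) ⊆ W_{2p} X` (`MixedHodgeStructure.hodgeClasses_le_W`) and `Hdgᵖ(X) ∩ W_{2p-1} X = 0`
(`eq_zero_of_mem_hodgeClasses_of_mem_W`), the Hodge classes of `X` are read off the truncations: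

* §1 **`Hdgᵖ(W_k X) ⥲ Hdgᵖ(X)` for `2p ≤ k`** (`isIso_hodgeClassesFunctor_map_weightι_app`; the natural isomorphism
  **`hodgeClassesWeightIso : weightFunctor k ⋙ hodgeClassesFunctor p ≅ hodgeClassesFunctor p`**), and `Hdgᵖ(W_k X) = 0` for `k < 2p`;
* §2 **`Hdgᵖ(X) ↪ Hdgᵖ(X ∕ W_k X)` is injective for `k < 2p`** (`hodgeClassesFunctor_map_weightπ_app_injective`; NOT surjective in general —
  extensions obstruct), and `Hdgᵖ(X ∕ W_k X) = 0` for `2p ≤ k`;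
* §3 the comparison **`hodgeClassesToWeightTrunc : hodgeClassesFunctor p ⟶ weightTrunc a b ⋙ hodgeClassesFunctor p`** (`2p ≤ b`), injective
  on every `X` when moreover `a ≤ 2p` (`mono_hodgeClassesToWeightTrunc`), and `Hdgᵖ(W_{[a,b]} X) = 0` when `2p ∉ [a, b]`.

Everything is PROVED; definitions with bodies (`hodgeClassesWeightIso`, `hodgeClassesToWeightTrunc`); no named fact, no instance, no notation.

Sources.  D. Arapura, *Hodge cycles and the Leray filtration*, Pacific J. Math. 319 (2022) [Arapura2022], §1 (p. 3) and Lemma 1.1 (Hodge cycles of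
a MHS: `Hdgᵖ(H) = Hom_MHS(ℚ(-p), H)`, contained in `W_{2p}`, meeting `W_{2p-1}` trivially, injecting into those of `Gr^W_{2p} H`; cited through the tree's
`Motives/MixedHodgeStructureHodgeClasses`, whose docstrings quote it).  E. Cattani, F. El Zein, P. A. Griffiths, Lê D. T. (eds.), *Hodge Theory* (2014)
[CattaniElZeinGriffithsLe2014] (held text `book:cattani2014-hodge-theory-princeton-mathematical-notes-49`): Lemma 3.2.20 (p0161 L1) sub- and
quotient MHS «are endowed with induced filtrations (resp. quotient filtrations) by `W`», Cor. 3.2.21 (i) (p0161 L13) «Each morphism `f : H → H'` is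
strictly compatible with the filtrations `W` …».  P. Deligne, *Théorie de Hodge II* [DeligneHodgeII1971], 2.3.1, Thm. 2.3.5 (iii).

## Main definitions and results

* §1 `hodgeClassesFunctor_map_injective`, `hodgeClassesFunctor_map_weightι_app_injective`, `weightsIn_Iic_tateObj`,
  `hodgeClassesFunctor_map_weightι_app_surjective`, **`isIso_hodgeClassesFunctor_map_weightι_app`**, **`hodgeClassesWeightIso`** (+ `_hom_app` rfl),
  `hodgeClasses_weightFunctor_obj_eq_bot`, `isZero_hodgeClassesFunctor_obj_weightFunctor_obj`.
* §2 **`hodgeClassesFunctor_map_weightπ_app_injective`**, `mono_hodgeClassesFunctor_map_weightπ_app`, `hodgeClasses_weightQuotFunctor_obj_eq_bot`,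
  `isZero_hodgeClassesFunctor_obj_weightQuotFunctor_obj`, `hodgeClassesFunctor_map_weightπ_app_eq_zero`.
* §3 **`hodgeClassesToWeightTrunc`** (+ `_app`), **`hodgeClassesToWeightTrunc_app_injective`**, `mono_hodgeClassesToWeightTrunc_app`,
  `mono_hodgeClassesToWeightTrunc`, `hodgeClasses_weightTrunc_obj_eq_bot_of_lt`, `hodgeClasses_weightTrunc_obj_eq_bot_of_gt`.

## References

* [Arapura2022] D. Arapura, Hodge cycles and the Leray filtration, Pacific J. Math. 319 (2022), no. 2, 233–258, §1, Lemma 1.1.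
* [CattaniElZeinGriffithsLe2014] E. Cattani et al. (eds.), Hodge Theory, Princeton Math. Notes 49 (2014), Lemma 3.2.20, Cor. 3.2.21.
* [DeligneHodgeII1971] P. Deligne, Théorie de Hodge II, Publ. Math. IHÉS 40 (1971), 2.3.1, Thm. 2.3.5.

## Provenance

Lane `lit-hodgefound` (summit `HodgeConjecture`), seat `lit-hodgefound-p36` (literature-prover, generation 44, row g44-#11).
-/

noncomputable section

open CategoryTheory CategoryTheory.Limits

namespace Literature.AlgebraicGeometry.Motives

universe u

namespace MixedHodgeStructureCat

/-! ## §1 `Hdgᵖ(W_k X) = Hdgᵖ(X)` for `k ≥ 2p` -/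

/-- `Hdgᵖ(f)` is injective when `f` is injective on the underlying spaces. [cite: Arapura2022, §1 Lemma 1.1] -/
theorem hodgeClassesFunctor_map_injective (p : ℤ) {X Y : MixedHodgeStructureCat.{u}} (f : X ⟶ Y) (hf : Function.Injective f.toLinearMap) :
    Function.Injective ((hodgeClassesFunctor p).map f).hom := fun v w h =>
  Subtype.ext (hf (by rw [← coe_hodgeClassesFunctor_map_apply, ← coe_hodgeClassesFunctor_map_apply, h]))

/-- `Hdgᵖ(W_k X) → Hdgᵖ(X)` is injective. [cite: Arapura2022, §1 Lemma 1.1] [cite: CattaniElZeinGriffithsLe2014, Lemma 3.2.20] -/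
theorem hodgeClassesFunctor_map_weightι_app_injective (p k : ℤ) (X : MixedHodgeStructureCat.{u}) :
    Function.Injective ((hodgeClassesFunctor p).map ((weightι k).app X)).hom :=
  hodgeClassesFunctor_map_injective p _ Subtype.val_injective

/-- `ℚ(-p)` (pure of weight `2p`) has weights `≤ k` when `2p ≤ k`. [cite: CattaniElZeinGriffithsLe2014, Ex. 3.2.23 (4)] -/
theorem weightsIn_Iic_tateObj {p k : ℤ} (h : 2 * p ≤ k) : weightsIn (Set.Iic k) (tateObj.{u} (-p)) :=
  weightsIn_of_subset (Set.singleton_subset_iff.2 (Set.mem_Iic.2 (by omega))) (weightsIn_tateObj (-p))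

/-- **`Hdgᵖ(W_k X) → Hdgᵖ(X)` is surjective for `2p ≤ k`**: a Hodge class `v = f(1)`, `f : ℚ(-p) → X`, and `f` factors through `W_k X ↪ X` because
`ℚ(-p)` has weight `2p ≤ k` (`weightLift`). [cite: Arapura2022, §1 Lemma 1.1] [cite: CattaniElZeinGriffithsLe2014, Cor. 3.2.21 (i)] -/
theorem hodgeClassesFunctor_map_weightι_app_surjective {p k : ℤ} (h : 2 * p ≤ k) (X : MixedHodgeStructureCat.{u}) :
    Function.Surjective ((hodgeClassesFunctor p).map ((weightι k).app X)).hom := fun w => by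
  set f : tateObj.{u} (-p) ⟶ X := (homTateLinearEquiv p X).symm w
  refine ⟨⟨(weightLift (weightsIn_Iic_tateObj h) f).toLinearMap (ULift.up 1), apply_one_mem_hodgeClasses p _⟩, Subtype.ext ?_⟩
  rw [coe_hodgeClassesFunctor_map_apply]
  change Subtype.val ((weightLift (weightsIn_Iic_tateObj h) f).toLinearMap (ULift.up 1)) = Subtype.val w
  rw [coe_weightLift_apply, homTateLinearEquiv_symm_apply_toLinearMap_apply, one_smul]

/-- **`Hdgᵖ(W_k X) ⥲ Hdgᵖ(X)` for `2p ≤ k`.** [cite: Arapura2022, §1 Lemma 1.1] [cite: CattaniElZeinGriffithsLe2014, Cor. 3.2.21 (i)] -/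
theorem isIso_hodgeClassesFunctor_map_weightι_app {p k : ℤ} (h : 2 * p ≤ k) (X : MixedHodgeStructureCat.{u}) :
    IsIso ((hodgeClassesFunctor p).map ((weightι k).app X)) := by
  change IsIso (LinearEquiv.ofBijective ((hodgeClassesFunctor p).map ((weightι k).app X)).hom
    ⟨hodgeClassesFunctor_map_weightι_app_injective p k X, hodgeClassesFunctor_map_weightι_app_surjective h X⟩).toModuleIso.hom
  infer_instance

/-- **`W_k ⋙ Hdgᵖ ≅ Hdgᵖ` for `2p ≤ k`**: the Hodge classes of type `(p,p)` only see `W_{2p}`. [cite: Arapura2022, §1 Lemma 1.1]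
[cite: CattaniElZeinGriffithsLe2014, Cor. 3.2.21 (i)] -/
def hodgeClassesWeightIso {p k : ℤ} (h : 2 * p ≤ k) : weightFunctor.{u} k ⋙ hodgeClassesFunctor p ≅ hodgeClassesFunctor p :=
  NatIso.ofComponents (F := weightFunctor.{u} k ⋙ hodgeClassesFunctor p) (G := hodgeClassesFunctor p)
    (fun X => @asIso _ _ ((hodgeClassesFunctor p).obj ((weightFunctor k).obj X)) ((hodgeClassesFunctor p).obj X)
      ((hodgeClassesFunctor p).map ((weightι k).app X)) (isIso_hodgeClassesFunctor_map_weightι_app h X))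
    fun f => by
      change (hodgeClassesFunctor p).map ((weightFunctor k).map f) ≫ (hodgeClassesFunctor p).map ((weightι k).app _) =
        (hodgeClassesFunctor p).map ((weightι k).app _) ≫ (hodgeClassesFunctor p).map f
      rw [← (hodgeClassesFunctor p).map_comp, ← (hodgeClassesFunctor p).map_comp]
      exact congrArg _ ((weightι k).naturality f)

/-- The components of `hodgeClassesWeightIso h` are `Hdgᵖ(W_k X ↪ X)` (by `rfl`). [cite: Arapura2022, §1 Lemma 1.1] -/
theorem hodgeClassesWeightIso_hom_app {p k : ℤ} (h : 2 * p ≤ k) (X : MixedHodgeStructureCat.{u}) :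
    (hodgeClassesWeightIso h).hom.app X = (hodgeClassesFunctor p).map ((weightι k).app X) := rfl

/-- `Hdgᵖ(W_k X) = 0` for `k < 2p` (`W_k X` has weights `≤ k < 2p`). [cite: Arapura2022, §1 Lemma 1.1 (1)] [cite: CattaniElZeinGriffithsLe2014, Lemma 3.2.20] -/
theorem hodgeClasses_weightFunctor_obj_eq_bot {p k : ℤ} (h : k < 2 * p) (X : MixedHodgeStructureCat.{u}) :
    ((weightFunctor k).obj X).str.hodgeClasses p = ⊥ :=
  hodgeClasses_eq_bot_of_weightsIn p (weightsIn_Iic_weightFunctor_obj k X) fun hk => (Set.mem_Iic.1 hk).not_gt h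

/-- `Hdgᵖ(W_k X)` is a zero module for `k < 2p`. [cite: Arapura2022, §1 Lemma 1.1 (1)] [cite: CattaniElZeinGriffithsLe2014, Lemma 3.2.20] -/
theorem isZero_hodgeClassesFunctor_obj_weightFunctor_obj {p k : ℤ} (h : k < 2 * p) (X : MixedHodgeStructureCat.{u}) :
    IsZero ((hodgeClassesFunctor p).obj ((weightFunctor k).obj X)) :=
  isZero_hodgeClassesFunctor_obj_of_not_isWeight p fun hk => (Set.mem_Iic.1 (weightsIn_Iic_weightFunctor_obj k X hk)).not_gt h

/-! ## §2 `Hdgᵖ(X) ↪ Hdgᵖ(X ∕ W_k X)` for `k < 2p` -/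

/-- **`Hdgᵖ(X) → Hdgᵖ(X ∕ W_k X)` is injective for `k < 2p`**: a Hodge class dying in the quotient lies in `W_k X ⊆ W_{2p-1} X`, hence is `0`
(`Hdgᵖ ∩ W_{2p-1} = 0`, strictness). [cite: Arapura2022, §1 Lemma 1.1 (1)] [cite: CattaniElZeinGriffithsLe2014, Cor. 3.2.21 (i)] -/
theorem hodgeClassesFunctor_map_weightπ_app_injective {p k : ℤ} (h : k < 2 * p) (X : MixedHodgeStructureCat.{u}) :
    Function.Injective ((hodgeClassesFunctor p).map ((weightπ k).app X)).hom := by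
  refine (injective_iff_map_eq_zero _).2 fun v hv => Subtype.ext ?_
  have h0 : ((weightπ k).app X).toLinearMap (Subtype.val v) = 0 := by rw [← coe_hodgeClassesFunctor_map_apply, hv]; rfl
  have hW : Subtype.val v ∈ X.str.W k := (Submodule.Quotient.mk_eq_zero _).1 h0
  exact X.str.eq_zero_of_mem_hodgeClasses_of_mem_W v.2 (X.str.monotone_W (show k ≤ 2 * p - 1 by omega) hW)

/-- `Hdgᵖ(X) → Hdgᵖ(X ∕ W_k X)` is a monomorphism for `k < 2p`. [cite: Arapura2022, §1 Lemma 1.1 (1)] -/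
theorem mono_hodgeClassesFunctor_map_weightπ_app {p k : ℤ} (h : k < 2 * p) (X : MixedHodgeStructureCat.{u}) :
    Mono ((hodgeClassesFunctor p).map ((weightπ k).app X)) :=
  (ModuleCat.mono_iff_injective _).2 (hodgeClassesFunctor_map_weightπ_app_injective h X)

/-- `Hdgᵖ(X ∕ W_k X) = 0` for `2p ≤ k` (`X ∕ W_k X` has weights `> k ≥ 2p`). [cite: Arapura2022, §1 Lemma 1.1] [cite: CattaniElZeinGriffithsLe2014, Lemma 3.2.20] -/
theorem hodgeClasses_weightQuotFunctor_obj_eq_bot {p k : ℤ} (h : 2 * p ≤ k) (X : MixedHodgeStructureCat.{u}) :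
    ((weightQuotFunctor k).obj X).str.hodgeClasses p = ⊥ :=
  hodgeClasses_eq_bot_of_weightsIn p (weightsIn_Ioi_weightQuotFunctor_obj k X) fun hk => (Set.mem_Ioi.1 hk).not_ge h

/-- `Hdgᵖ(X ∕ W_k X)` is a zero module for `2p ≤ k`. [cite: Arapura2022, §1 Lemma 1.1] [cite: CattaniElZeinGriffithsLe2014, Lemma 3.2.20] -/
theorem isZero_hodgeClassesFunctor_obj_weightQuotFunctor_obj {p k : ℤ} (h : 2 * p ≤ k) (X : MixedHodgeStructureCat.{u}) :
    IsZero ((hodgeClassesFunctor p).obj ((weightQuotFunctor k).obj X)) :=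
  isZero_hodgeClassesFunctor_obj_of_not_isWeight p fun hk => (Set.mem_Ioi.1 (weightsIn_Ioi_weightQuotFunctor_obj k X hk)).not_ge h

/-- Hence `Hdgᵖ(X ↠ X ∕ W_k X) = 0` for `2p ≤ k`. [cite: Arapura2022, §1 Lemma 1.1] -/
theorem hodgeClassesFunctor_map_weightπ_app_eq_zero {p k : ℤ} (h : 2 * p ≤ k) (X : MixedHodgeStructureCat.{u}) :
    (hodgeClassesFunctor p).map ((weightπ k).app X) = 0 :=
  (isZero_hodgeClassesFunctor_obj_weightQuotFunctor_obj h X).eq_of_tgt _ _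

/-! ## §3 `Hdgᵖ(X) ↪ Hdgᵖ(W_{[a,b]} X)` -/

/-- **The comparison `Hdgᵖ ⟶ W_{[a,b]} ⋙ Hdgᵖ` (`2p ≤ b`)**: `Hdgᵖ(X) = Hdgᵖ(W_b X) → Hdgᵖ(W_b X ∕ W_{a-1}(W_b X)) = Hdgᵖ(W_{[a,b]} X)`.
[cite: Arapura2022, §1 Lemma 1.1] [cite: CattaniElZeinGriffithsLe2014, Lemma 3.2.20 and Cor. 3.2.21 (i)] -/
def hodgeClassesToWeightTrunc (p a : ℤ) {b : ℤ} (hb : 2 * p ≤ b) : hodgeClassesFunctor.{u} p ⟶ weightTrunc a b ⋙ hodgeClassesFunctor p :=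
  (hodgeClassesWeightIso hb).inv ≫ Functor.whiskerRight (weightTruncπ a b) (hodgeClassesFunctor p)

/-- The components of `hodgeClassesToWeightTrunc`: `inv Hdgᵖ(W_b X ↪ X) ≫ Hdgᵖ(W_b X ↠ W_{[a,b]} X)`. [cite: Arapura2022, §1 Lemma 1.1] -/
theorem hodgeClassesToWeightTrunc_app (p a : ℤ) {b : ℤ} (hb : 2 * p ≤ b) (X : MixedHodgeStructureCat.{u}) :
    (hodgeClassesToWeightTrunc p a hb).app X =
      (hodgeClassesWeightIso hb).inv.app X ≫ (hodgeClassesFunctor p).map ((weightTruncπ a b).app X) := rfl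

/-- **`Hdgᵖ(X) ↪ Hdgᵖ(W_{[a,b]} X)` is injective for `a ≤ 2p ≤ b`.** [cite: Arapura2022, §1 Lemma 1.1] [cite: CattaniElZeinGriffithsLe2014, Cor. 3.2.21 (i)] -/
theorem hodgeClassesToWeightTrunc_app_injective {p a b : ℤ} (ha : a ≤ 2 * p) (hb : 2 * p ≤ b) (X : MixedHodgeStructureCat.{u}) :
    Function.Injective ((hodgeClassesToWeightTrunc p a hb).app X).hom := by
  have hi : Function.Injective ((hodgeClassesWeightIso.{u} hb).inv.app X).hom := ((hodgeClassesWeightIso.{u} hb).app X).symm.toLinearEquiv.injective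
  exact (hodgeClassesFunctor_map_weightπ_app_injective (show a - 1 < 2 * p by omega) ((weightFunctor b).obj X)).comp hi

/-- The components of `hodgeClassesToWeightTrunc` are monomorphisms for `a ≤ 2p ≤ b`. [cite: Arapura2022, §1 Lemma 1.1] -/
theorem mono_hodgeClassesToWeightTrunc_app {p a b : ℤ} (ha : a ≤ 2 * p) (hb : 2 * p ≤ b) (X : MixedHodgeStructureCat.{u}) :
    Mono ((hodgeClassesToWeightTrunc p a hb).app X) :=
  (ModuleCat.mono_iff_injective _).2 (hodgeClassesToWeightTrunc_app_injective ha hb X)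

/-- `hodgeClassesToWeightTrunc` is a monomorphism of functors for `a ≤ 2p ≤ b`. [cite: Arapura2022, §1 Lemma 1.1] -/
theorem mono_hodgeClassesToWeightTrunc {p a b : ℤ} (ha : a ≤ 2 * p) (hb : 2 * p ≤ b) : Mono (hodgeClassesToWeightTrunc.{u} p a hb) :=
  haveI := fun X => mono_hodgeClassesToWeightTrunc_app.{u} ha hb X
  NatTrans.mono_of_mono_app _

/-- `Hdgᵖ(W_{[a,b]} X) = 0` when `b < 2p`. [cite: Arapura2022, §1 Lemma 1.1 (1)] [cite: CattaniElZeinGriffithsLe2014, Lemma 3.2.20] -/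
theorem hodgeClasses_weightTrunc_obj_eq_bot_of_lt {p a b : ℤ} (h : b < 2 * p) (X : MixedHodgeStructureCat.{u}) :
    ((weightTrunc a b).obj X).str.hodgeClasses p = ⊥ :=
  hodgeClasses_eq_bot_of_weightsIn p (weightsIn_Icc_weightTrunc_obj a b X) fun hk => (Set.mem_Icc.1 hk).2.not_gt h

/-- `Hdgᵖ(W_{[a,b]} X) = 0` when `2p < a`. [cite: Arapura2022, §1 Lemma 1.1] [cite: CattaniElZeinGriffithsLe2014, Lemma 3.2.20] -/
theorem hodgeClasses_weightTrunc_obj_eq_bot_of_gt {p a b : ℤ} (h : 2 * p < a) (X : MixedHodgeStructureCat.{u}) :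
    ((weightTrunc a b).obj X).str.hodgeClasses p = ⊥ :=
  hodgeClasses_eq_bot_of_weightsIn p (weightsIn_Icc_weightTrunc_obj a b X) fun hk => (Set.mem_Icc.1 hk).1.not_gt h

end MixedHodgeStructureCat

end Literature.AlgebraicGeometry.Motives

end
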